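import Summits.BirchSwinnertonDyer.BirchSwinnertonDyer.Theorems.ClassRecordThreeEulerHalvesAtThreeKolyvaginRedefinition
import HarnessLib

/-!
# PORT 3 ↦ p, layer 1 (crux `EulerHalfNotRamNoInertSetAtFive`, item stmt-BirchSwinnertonDyer-19715, deciding stub `stub_jetchevAtP`;
# RULING 52 «Jetchev-at-p = port the p = 3 chain», (P1) certificate HOME/line-er5-p1/w2/jet3_essential_uses.txt):
# Kolyvagin's redefinition of `m_∞` (McCallum Prop. 5.2) and the per-level ⟹ HL step, AT A GENERAL ODD PRIME `p`

Cell `bsd-stepL`, seat `bsd-line-er5-p1-w2` (D-0154 width seat -w2; lead `bsd-line-er5-p1`), `--supports stmt-BirchSwinnertonDyer-19715`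
(helper). THEOREMS ONLY (no definition, no named fact, no `sorry`), Theses-free (r3), namespace `…X11b.AtP.Koly` (P3).
The p = 3 originals (NOT edited): `…KolyvaginRedefinition.lean` §4–§5 (`Three.Koly.jetchevMaxHLAtThree_hK_of_prop52`,
`…_of_prop52_of_perLevel`) and `…JetchevMaxOfPerLevel.lean` (`Three.Koly.jetchevMaxHLAtThree_of_perLevel`); their cores
`Three.Koly.exists_mInf_of_prop52` and `Three.Koly.pDiv_of_perLevel` ALREADY take `p` as a binder and are reused as they stand.
PORT RULE (P2): every `3` that is the BSD prime becomes the binder `(p : ℕ) [Fact p.Prime]` with the weakest side condition its proof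
uses — here `p ≠ 2` (the `p`-adic tower `forall_hasSurjectiveModNGaloisRep_pow_of_multiplicative_of_surj`, Wuthrich Lemma 20 shape,
is generic in `p ≠ 2`); the ONE non-parametric step of the originals, «`3 ∣ N` + Heegner ⟹ `3 ∤ d_K` ⟹ `d_K ≠ −3`», has no analogue at
`p ≠ 3`, so THE FRAME GAINS THE EXPLICIT BINDER `NumberField.discr K ≠ -3` (McCallum's `w_K` bookkeeping; placed right after
`Odd (NumberField.discr K)`; at the class level it comes from the Friedberg–Hoffstein ∕ Hoffstein–Luo field's `|d_K| > 4`).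
Everything else is the original text with `3 ↦ p` (audit by diff, P3).

* `jetchevMaxHLAtP_hK_of_prop52` — the `hK` input (Kolyvagin's `m_∞` with attainment) at every AtP frame, from McCallum Prop. 5.2 (`h52`,
  typed fact) + a conductor-1 datum with `y_K` of infinite order (`hy`, Gross–Zagier grade).
  -- adapted from Summits/BirchSwinnertonDyer/BirchSwinnertonDyer/Theorems/ClassRecordThreeEulerHalvesAtThreeKolyvaginRedefinition.lean
* `jetchevMaxHLAtP_of_perLevel` — `hK` + the per-level inequality `hlev` ⟹ the HL statement at `p` (global `p^s`-divisibility `PDiv d p s` of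
  every derived Heegner point on admissible levels of index `≥ s`, for every place `v` and `s ≤ ord_p c_v` — `v = (p)` NOT excluded).
  -- adapted from Summits/BirchSwinnertonDyer/BirchSwinnertonDyer/Theorems/ClassRecordThreeEulerHalvesAtThreeJetchevMaxOfPerLevel.lean
* `jetchevMaxHLAtP_of_prop52_of_perLevel` — the composition.

HONEST FRAMING: CONDITIONAL on the displayed binders (`h52` = McCallum 1991 Prop. 5.2 as typed, carrying the tower-surjectivity binder
and the flag Kolyvagin1991-LNM1479-primary-unread (r2); `hy`; `hlev`); nothing booked; no census label moves (T7); `stub_jetchevAtP` and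
crux 19715 are NOT closed by this layer; BSD is proved for no curve. [cite: McCallumLMS1991, §5 Lemma 5.1, Prop. 5.2 (pp. 303–306)]
[cite: Jetchev2008, Thm. 1.4 (p. 812), Proof of Thm. 1.4 (p. 825)] [cite: Wuthrich2014, Lemma 20 (p. 399)]
-/

set_option autoImplicit false

noncomputable section

open scoped Classical NumberField

namespace Summit.BirchSwinnertonDyer.Rank1Residual.X11b.AtP.Koly

open WeierstrassCurve Literature.NumberTheory.EllipticCurves
  Literature.NumberTheory.EllipticCurves.ModularForms
  Literature.NumberTheory.EllipticCurves.Rank1Residual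
  Summit.BirchSwinnertonDyer.Rank1Residual Summit.BirchSwinnertonDyer.Rank1Residual.X11b
  Summit.BirchSwinnertonDyer.Rank1Residual.X11b.Three.Koly
  IsDedekindDomain

/-- **The `hK` binder of `jetchevMaxHLAtP_of_perLevel` from McCallum's Prop. 5.2 and a
conductor-1 datum with `y_K` of infinite order, at every frame of `stub_jetchevMaxHLAtP`.** The
frame gives Prop. 5.2's binders: `¬CM` (multiplicative at 3, `not_hasCM_of_hasMultiplicativeReductionAtPrime'`),
`d_K ≠ −3` (`3 ∣ N` and the Heegner hypothesis make `3 ∤ d_K`), `d_K ≠ −4` (`d_K` odd), the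
3-adic tower (`forall_hasSurjectiveModNGaloisRep_pow_of_multiplicative_of_surj`, Wuthrich Lemma 20),
ring class fields number fields (`JET.numberField_ringClassField`, `Rank1ResidualJetRingClassFields.lean`).
The remaining per-frame input `hy` — SOME conductor-1 datum has `P_1 = y_K` of infinite order — is
Gross–Zagier grade (`L'(E/K,1) ≠ 0` on the frame; `gross_zagier`, item 19112 conjunct 1) and stays
a hypothesis.
[cite: McCallumLMS1991, §5 Prop. 5.2 (p. 304)] [cite: Wuthrich2014, Lemma 20 (p. 399)] -/
theorem jetchevMaxHLAtP_hK_of_prop52 (p : ℕ) [Fact p.Prime] (hp2 : p ≠ 2)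
    (h52 : McCallum1991.prop52_exists_conductor_kolyvaginClass_order_eq)
    (hy : ∀ (W : WeierstrassCurve ℚ) [W.IsElliptic] [W.IsGloballyMinimal] [NeZero (W.conductorNorm ℤ)]
      (K : Type) [Field K] [NumberField K]
      (Dt : ModularParametrizationData W (W.conductorNorm ℤ)) (β : ℤ) (ι : K →+* ℂ),
      W.analyticRank = 1 → W.HasMultiplicativeReductionAtPrime p → Surj W p →
      IsImaginaryQuadratic K → SatisfiesHeegnerHypothesis (W.conductorNorm ℤ) K →
      Odd (NumberField.discr K) → NumberField.discr K ≠ -3 → (W.quadraticTwist (NumberField.discr K : ℚ)).entireLFunction 1 ≠ 0 →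
      (4 * (W.conductorNorm ℤ : ℤ)) ∣ β ^ 2 - NumberField.discr K → ¬ (p : ℤ) ∣ Dt.c →
      ∃ d₁ : KolyvaginHeegnerData Dt β ι 1, ¬ IsOfFinAddOrder d₁.derivedPoint)
    (W : WeierstrassCurve ℚ) [W.IsElliptic] [W.IsGloballyMinimal] [NeZero (W.conductorNorm ℤ)]
    (K : Type) [Field K] [NumberField K]
    (Dt : ModularParametrizationData W (W.conductorNorm ℤ)) (β : ℤ) (ι : K →+* ℂ)
    (hr : W.analyticRank = 1) (hmult : W.HasMultiplicativeReductionAtPrime p) (hρ : Surj W p)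
    (hK : IsImaginaryQuadratic K) (hHN : SatisfiesHeegnerHypothesis (W.conductorNorm ℤ) K)
    (hodd : Odd (NumberField.discr K)) (hD3 : NumberField.discr K ≠ -3)
    (hLt : (W.quadraticTwist (NumberField.discr K : ℚ)).entireLFunction 1 ≠ 0)
    (hβ : (4 * (W.conductorNorm ℤ : ℤ)) ∣ β ^ 2 - NumberField.discr K) (hc : ¬ (p : ℤ) ∣ Dt.c) :
    ∃ mInf : ℕ,
      (∀ (n : ℕ) (d : KolyvaginHeegnerData Dt β ι n), Squarefree n →
        (∀ ℓ ∈ n.primeFactors, Zhang2014.IsKolyvaginPrime (W.conductorNorm ℤ) W K p ℓ) →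
        (mInf : ℕ∞) ≤ (if divOrd d p < Zhang2014.levelIndex W p n then divOrd d p else ⊤)) ∧
      (∀ m' : ℕ, ∃ (n : ℕ) (d : KolyvaginHeegnerData Dt β ι n), Squarefree n ∧
        (∀ ℓ ∈ n.primeFactors, Zhang2014.IsKolyvaginPrime (W.conductorNorm ℤ) W K p ℓ) ∧
        (m' : ℕ∞) ≤ Zhang2014.levelIndex W p n ∧
        (if divOrd d p < Zhang2014.levelIndex W p n then divOrd d p else (⊤ : ℕ∞)) = mInf) := by
  obtain ⟨d₁, hy₁⟩ := hy W K Dt β ι hr hmult hρ hK hHN hodd hD3 hLt hβ hc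
  -- Prop. 5.2's binders from the frame
  have hcm : ¬ W.HasCM := not_hasCM_of_hasMultiplicativeReductionAtPrime' W hmult
  have hD4 : NumberField.discr K ≠ -4 := by
    rintro h; rw [h] at hodd; exact absurd hodd (by decide)
  have htower : ∀ n : ℕ, W.HasSurjectiveModNGaloisRep (p ^ n : ℕ) :=
    forall_hasSurjectiveModNGaloisRep_pow_of_multiplicative_of_surj W p hp2 hmult hρ
  haveI : ∀ k : ℕ, NumberField (ringClassField K ι k) :=
    Summit.BirchSwinnertonDyer.Rank1Residual.JET.numberField_ringClassField K hK ι
  exact exists_mInf_of_prop52 h52 W hcm K hK hD3 hD4 hHN p hp2 htower Dt β ι d₁ hy₁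


/-- **`stub_jetchevMaxHLAtP` ⟸ {Kolyvagin's redefinition of `m_∞` at the frame, the per-level
inequality at the frame}, everything else kernel.** For every Hoffstein–Luo-type frame of the stub
(`r_an = 1`, `3 ∥ N` multiplicative, `Surj W p`, `K` imaginary quadratic Heegner with `d_K` odd,
`L(E^{d_K},1) ≠ 0`, orientation `β`, Manin-good datum `Dt`), write `m(n) :=` McCallum's
`ord₃(P_n)` when `ord₃(P_n) < M(n)` and `∞` otherwise (`Koly.divOrd`, `Zhang2014.levelIndex`; the
convention of `n ∈ S_r(ord_p P_n + 1)`, McCallum §5 p. 303), on ADMISSIBLE conductors (square-free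
products of Kolyvagin primes, `Zhang2014.IsKolyvaginPrime`). HYPOTHESES, per frame: `hK` = «`m_∞` is a
natural number `≤ m(n)` for all admissible `(n, d)` and is attained at admissible conductors of
arbitrarily large `M(n)`» (McCallum 1991 Lemma 5.1 + Prop. 5.2 for `y_K` of infinite order — PRINT,
the S9 input; not typed here); `hlev` = for every finite place `v` of `ℚ`, level `k` and admissible
`(n, d)` with `m(n) < k`, `ord₃ c_v ≤ k`, `k + m(n) ≤ M(n)`: `ord₃ c_v ≤ m(n)` — the conclusion of
`JET.Section6.tamagawaExponent_le_m_of_selmerFamilies` (p484791) with `t = ord₃ c_v` once its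
level-`3^k` Selmer families are instantiated at `(n, d)` (the carrier `q = char v`; for `3 ∤ c_v`,
`t = 0` and `hlev` is trivial) — the instantiation layer, NOT in the tree. CONCLUSION: the statement of
`stub_jetchevMaxHLAtP` VERBATIM (every derived Heegner point of the frame at an admissible
conductor with all Kolyvagin indices `≥ s ≤ ord₃ c_v` is `3^s`-divisible). PROOF: `pDiv_of_perLevel`
(`…Section6Bridge.lean`) at `p = 3`, `t = ord₃ c_v`. Nothing is discharged unconditionally; the stub
stays open; 0 classes move. [cite: Jetchev2008, Thm. 1.4 (p. 812), Proof of Thm. 1.4 (p. 825)]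
[cite: McCallumLMS1991, §5 Lemma 5.1, Prop. 5.2 (pp. 303–304)] -/
theorem jetchevMaxHLAtP_of_perLevel (p : ℕ) [Fact p.Prime]
    (hK : ∀ (W : WeierstrassCurve ℚ) [W.IsElliptic] [W.IsGloballyMinimal] [NeZero (W.conductorNorm ℤ)]
      (K : Type) [Field K] [NumberField K]
      (Dt : ModularParametrizationData W (W.conductorNorm ℤ)) (β : ℤ) (ι : K →+* ℂ),
      W.analyticRank = 1 → W.HasMultiplicativeReductionAtPrime p → Surj W p →
      IsImaginaryQuadratic K → SatisfiesHeegnerHypothesis (W.conductorNorm ℤ) K →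
      Odd (NumberField.discr K) → NumberField.discr K ≠ -3 → (W.quadraticTwist (NumberField.discr K : ℚ)).entireLFunction 1 ≠ 0 →
      (4 * (W.conductorNorm ℤ : ℤ)) ∣ β ^ 2 - NumberField.discr K → ¬ (p : ℤ) ∣ Dt.c →
      ∃ mInf : ℕ,
        (∀ (n : ℕ) (d : KolyvaginHeegnerData Dt β ι n), Squarefree n →
          (∀ ℓ ∈ n.primeFactors, Zhang2014.IsKolyvaginPrime (W.conductorNorm ℤ) W K p ℓ) →
          (mInf : ℕ∞) ≤
            (if divOrd d p < Zhang2014.levelIndex W p n then divOrd d p else ⊤)) ∧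
        (∀ m' : ℕ, ∃ (n : ℕ) (d : KolyvaginHeegnerData Dt β ι n), Squarefree n ∧
          (∀ ℓ ∈ n.primeFactors, Zhang2014.IsKolyvaginPrime (W.conductorNorm ℤ) W K p ℓ) ∧
          (m' : ℕ∞) ≤ Zhang2014.levelIndex W p n ∧
          (if divOrd d p < Zhang2014.levelIndex W p n then divOrd d p else (⊤ : ℕ∞)) = mInf))
    (hlev : ∀ (W : WeierstrassCurve ℚ) [W.IsElliptic] [W.IsGloballyMinimal] [NeZero (W.conductorNorm ℤ)]
      (K : Type) [Field K] [NumberField K]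
      (Dt : ModularParametrizationData W (W.conductorNorm ℤ)) (β : ℤ) (ι : K →+* ℂ),
      W.analyticRank = 1 → W.HasMultiplicativeReductionAtPrime p → Surj W p →
      IsImaginaryQuadratic K → SatisfiesHeegnerHypothesis (W.conductorNorm ℤ) K →
      Odd (NumberField.discr K) → NumberField.discr K ≠ -3 → (W.quadraticTwist (NumberField.discr K : ℚ)).entireLFunction 1 ≠ 0 →
      (4 * (W.conductorNorm ℤ : ℤ)) ∣ β ^ 2 - NumberField.discr K → ¬ (p : ℤ) ∣ Dt.c →
      ∀ (v : HeightOneSpectrum (𝓞 ℚ)) (k n : ℕ) (d : KolyvaginHeegnerData Dt β ι n), Squarefree n →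
        (∀ ℓ ∈ n.primeFactors, Zhang2014.IsKolyvaginPrime (W.conductorNorm ℤ) W K p ℓ) →
        (if divOrd d p < Zhang2014.levelIndex W p n then divOrd d p else (⊤ : ℕ∞)) < (k : ℕ∞) →
        padicValNat p (W.tamagawaNumberAt v) ≤ k →
        (k : ℕ∞) + (if divOrd d p < Zhang2014.levelIndex W p n then divOrd d p else ⊤) ≤
          Zhang2014.levelIndex W p n →
        (padicValNat p (W.tamagawaNumberAt v) : ℕ∞) ≤
          (if divOrd d p < Zhang2014.levelIndex W p n then divOrd d p else ⊤)) :
    ∀ (W : WeierstrassCurve ℚ) [W.IsElliptic] [W.IsGloballyMinimal] [NeZero (W.conductorNorm ℤ)]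
      (K : Type) [Field K] [NumberField K]
      (Dt : ModularParametrizationData W (W.conductorNorm ℤ)) (β : ℤ) (ι : K →+* ℂ),
      W.analyticRank = 1 → W.HasMultiplicativeReductionAtPrime p → Surj W p →
      IsImaginaryQuadratic K → SatisfiesHeegnerHypothesis (W.conductorNorm ℤ) K →
      Odd (NumberField.discr K) → NumberField.discr K ≠ -3 → (W.quadraticTwist (NumberField.discr K : ℚ)).entireLFunction 1 ≠ 0 →
      (4 * (W.conductorNorm ℤ : ℤ)) ∣ β ^ 2 - NumberField.discr K → ¬ (p : ℤ) ∣ Dt.c →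
      ∀ (v : HeightOneSpectrum (𝓞 ℚ)) (s : ℕ), s ≤ padicValNat p (W.tamagawaNumberAt v) →
        ∀ (n : ℕ) (d : KolyvaginHeegnerData Dt β ι n), Squarefree n →
          (∀ ℓ ∈ n.primeFactors, Zhang2014.IsKolyvaginPrime (W.conductorNorm ℤ) W K p ℓ ∧
            s ≤ Zhang2014.kolyvaginIndex W p ℓ) → PDiv d p s := by
  intro W _ _ _ K _ _ Dt β ι hr hmult hρ hK' hHN hodd hD3 hLt hβ hc v s hs n d hn hℓ
  obtain ⟨mInf, hmInf, hKol⟩ := hK W K Dt β ι hr hmult hρ hK' hHN hodd hD3 hLt hβ hc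
  exact pDiv_of_perLevel (Dt := Dt) (β := β) (ι := ι) p (padicValNat p (W.tamagawaNumberAt v)) mInf
    (fun n d => if divOrd d p < Zhang2014.levelIndex W p n then divOrd d p else ⊤)
    (fun n d _ _ h => by simp [h]) hmInf hKol
    (fun k n d hn' hℓ' h1 h2 h3 =>
      hlev W K Dt β ι hr hmult hρ hK' hHN hodd hD3 hLt hβ hc v k n d hn' hℓ' h1 h2 h3)
    s hs n d hn hℓ

/-- **`stub_jetchevMaxHLAtP` VERBATIM from: the typed McCallum 1991 Prop. 5.2
(`McCallum1991.prop52_exists_conductor_kolyvaginClass_order_eq`, S9), a conductor-1 datum with `y_K`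
of infinite order at every frame (`hy`, Gross–Zagier grade) and the per-level inequality (`hlev`, the output of
`JET.Section6.tamagawaExponent_le_m_of_selmerFamilies` once instantiated).** Composition of
`jetchevMaxHLAtP_hK_of_prop52` with `jetchevMaxHLAtP_of_perLevel` (p486881). Nothing is
discharged unconditionally; the stub stays open; 0 classes move.
[cite: McCallumLMS1991, §5 Prop. 5.2 (p. 304)] [cite: Jetchev2008, Thm. 1.4 (p. 812), Proof of Thm. 1.4 (p. 825)] -/
theorem jetchevMaxHLAtP_of_prop52_of_perLevel (p : ℕ) [Fact p.Prime] (hp2 : p ≠ 2)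
    (h52 : McCallum1991.prop52_exists_conductor_kolyvaginClass_order_eq)
    (hy : ∀ (W : WeierstrassCurve ℚ) [W.IsElliptic] [W.IsGloballyMinimal] [NeZero (W.conductorNorm ℤ)]
      (K : Type) [Field K] [NumberField K]
      (Dt : ModularParametrizationData W (W.conductorNorm ℤ)) (β : ℤ) (ι : K →+* ℂ),
      W.analyticRank = 1 → W.HasMultiplicativeReductionAtPrime p → Surj W p →
      IsImaginaryQuadratic K → SatisfiesHeegnerHypothesis (W.conductorNorm ℤ) K →
      Odd (NumberField.discr K) → NumberField.discr K ≠ -3 → (W.quadraticTwist (NumberField.discr K : ℚ)).entireLFunction 1 ≠ 0 →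
      (4 * (W.conductorNorm ℤ : ℤ)) ∣ β ^ 2 - NumberField.discr K → ¬ (p : ℤ) ∣ Dt.c →
      ∃ d₁ : KolyvaginHeegnerData Dt β ι 1, ¬ IsOfFinAddOrder d₁.derivedPoint)
    (hlev : ∀ (W : WeierstrassCurve ℚ) [W.IsElliptic] [W.IsGloballyMinimal] [NeZero (W.conductorNorm ℤ)]
      (K : Type) [Field K] [NumberField K]
      (Dt : ModularParametrizationData W (W.conductorNorm ℤ)) (β : ℤ) (ι : K →+* ℂ),
      W.analyticRank = 1 → W.HasMultiplicativeReductionAtPrime p → Surj W p →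
      IsImaginaryQuadratic K → SatisfiesHeegnerHypothesis (W.conductorNorm ℤ) K →
      Odd (NumberField.discr K) → NumberField.discr K ≠ -3 → (W.quadraticTwist (NumberField.discr K : ℚ)).entireLFunction 1 ≠ 0 →
      (4 * (W.conductorNorm ℤ : ℤ)) ∣ β ^ 2 - NumberField.discr K → ¬ (p : ℤ) ∣ Dt.c →
      ∀ (v : HeightOneSpectrum (𝓞 ℚ)) (k n : ℕ) (d : KolyvaginHeegnerData Dt β ι n), Squarefree n →
        (∀ ℓ ∈ n.primeFactors, Zhang2014.IsKolyvaginPrime (W.conductorNorm ℤ) W K p ℓ) →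
        (if divOrd d p < Zhang2014.levelIndex W p n then divOrd d p else (⊤ : ℕ∞)) < (k : ℕ∞) →
        padicValNat p (W.tamagawaNumberAt v) ≤ k →
        (k : ℕ∞) + (if divOrd d p < Zhang2014.levelIndex W p n then divOrd d p else ⊤) ≤
          Zhang2014.levelIndex W p n →
        (padicValNat p (W.tamagawaNumberAt v) : ℕ∞) ≤
          (if divOrd d p < Zhang2014.levelIndex W p n then divOrd d p else ⊤)) :
    ∀ (W : WeierstrassCurve ℚ) [W.IsElliptic] [W.IsGloballyMinimal] [NeZero (W.conductorNorm ℤ)]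
      (K : Type) [Field K] [NumberField K]
      (Dt : ModularParametrizationData W (W.conductorNorm ℤ)) (β : ℤ) (ι : K →+* ℂ),
      W.analyticRank = 1 → W.HasMultiplicativeReductionAtPrime p → Surj W p →
      IsImaginaryQuadratic K → SatisfiesHeegnerHypothesis (W.conductorNorm ℤ) K →
      Odd (NumberField.discr K) → NumberField.discr K ≠ -3 → (W.quadraticTwist (NumberField.discr K : ℚ)).entireLFunction 1 ≠ 0 →
      (4 * (W.conductorNorm ℤ : ℤ)) ∣ β ^ 2 - NumberField.discr K → ¬ (p : ℤ) ∣ Dt.c →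
      ∀ (v : HeightOneSpectrum (𝓞 ℚ)) (s : ℕ), s ≤ padicValNat p (W.tamagawaNumberAt v) →
        ∀ (n : ℕ) (d : KolyvaginHeegnerData Dt β ι n), Squarefree n →
          (∀ ℓ ∈ n.primeFactors, Zhang2014.IsKolyvaginPrime (W.conductorNorm ℤ) W K p ℓ ∧
            s ≤ Zhang2014.kolyvaginIndex W p ℓ) → PDiv d p s :=
  jetchevMaxHLAtP_of_perLevel p
    (fun W _ _ _ K _ _ Dt β ι hr hmult hρ hK hHN hodd hD3 hLt hβ hc =>
      jetchevMaxHLAtP_hK_of_prop52 p hp2 h52 hy W K Dt β ι hr hmult hρ hK hHN hodd hD3 hLt hβ hc)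
    hlev

end Summit.BirchSwinnertonDyer.Rank1Residual.X11b.AtP.Koly

end
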